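import Literature.Analysis.FluidPDE.TaoAveragedBetaForm
import Literature.Analysis.FluidPDE.TaoAveragedSingleScaleAt
import HarnessLib

/-!
# Tao 2016, §3.3 with the base triple as a parameter: `B_{η;ξ}` is a DILATION-FREE complex average of `B`

T. Tao, *Finite time blowup for an averaged three-dimensional Navier–Stokes equation*,
J. Amer. Math. Soc. **29** (2016), 601–674 = arXiv:1402.0290v3, §3.3 "Third step: forcing frequency
comparability", p. 16. Sequel of `TaoAveragedBetaForm.lean` (the same step at Tao's normalisation
(3.7), `xi0`, ratios `√2, 1`) and of `TaoAveragedSingleScaleAt.lean` (`etaAt ξ ε₀`: the comparability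
weight `η` with the modulus ratios `‖ξ 1‖/‖ξ 0‖`, `‖ξ 2‖/‖ξ 0‖` of an ARBITRARY base triple `ξ`).
HONEST FRAMING (cell harvest/h2-tao-ladder, TAO-LADDER rung M_1 — MODEL statements about Tao's averaged
equation): this file re-runs the printed §3.3 argument verbatim with the two ratios as parameters; it
is used by the rung-1 support item `CascadeNoDilOfSingleScaleAt` (§3.3–§3.4 at a general closed base
triple) and says nothing about the true Navier–Stokes equations.

What the source says (p. 16): "`η(N₁,N₂,N₃) = η(1, e^{log(N₂/N₁)}, e^{log(N₃/N₁)})`, and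
`(x,y) ↦ η(1,eˣ,eʸ)` is a smooth compactly supported function. By Fourier inversion …
`B_η := ∫∫ ⟨B(D^{-it₂-it₃}u, D^{it₂}v), D^{it₃}w⟩ ϕ(t₂,t₃) dt₂dt₃` … then `B_η` is a complex average
of `B`". Nothing in this argument uses the particular ratios `√2, 1` of (3.7) beyond the fact that
`20ε₀²` is smaller than each ratio (compact support of the logarithmic profiles); for a base triple with
moduli in `[1/2, 2]` the ratios lie in `[1/4, 4]` and `ε₀ ≤ 1/10` suffices. The datum has no rotations
and NO DILATIONS (`λ ≡ 1`), exactly as `betaDatumAt`.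

Contents (parallel to `TaoAveragedBetaForm.lean`, whose generic lemmas — `cauchyDensity`,
`betaDatumMeasure`, `betaMomentBound`, `integrable_one_add_abs_pow_mul`, `Λ_smul₂`, `Λ_smul₃`,
`ae_freq_ne_zero` — are reused):
* `betaFormAt ξ ε₀` — `B_{η;ξ}` by its symbol `-πi ∫ η_ξ(|ξ₁|,|ξ₂|,|ξ₃|) Λ(û,v̂,ŵ)`;
* `etaProfileAt`, `etaAt_eq_etaProfileAt`, `hasCompactSupport_etaProfileAt` (ratios `≥ 1/4 > 20ε₀²`),
  `etaProfileAtS`, `etaPhiAt`, `integral_imagExp_mul_etaPhiAt` (Fourier inversion);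
* `betaCoefAt`, `betaSymbolAt`, `betaMomentAt_lt_top`, **`betaDatumAt`** (Ω = ℝ², Cauchy density,
  `m₁ = c(s)|ξ|^{-2πi(s₂+s₃)}`, `m₂ = |ξ|^{2πis₂}`, `m₃ = |ξ|^{2πis₃}`, `R = id`, `λ = 1`);
* `betaDatumAt_average_eulerForm` — the average of `B` over `betaDatumAt` is `betaFormAt` on
  `H¹⁰ × H¹⁰ × L²`; **`betaFormAt_isComplexAverageNoDil`** — for `0 < ε₀ ≤ 1/10` and moduli in
  `[1/2, 2]`, `B_{η;ξ}` is a dilation-free complex average of `B` (`IsComplexAverageNoDilOf`).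

## References

* T. Tao, J. Amer. Math. Soc. 29 (2016), 601–674, arXiv:1402.0290v3, §3.3 p. 16, Def. 3.4, (1.3),
  (1.10), (3.5); Remark 3.5 p. 20. Key `Tao2016AveragedNS`.
-/

noncomputable section

open Set Filter MeasureTheory FourierTransform
open scoped ENNReal NNReal Topology SchwartzMap FourierTransform

namespace Literature.Analysis.FluidPDE.Tao2016

/-- Local notation for physical / frequency space `ℝ³`. -/
local notation "ℝ³" => EuclideanSpace ℝ (Fin 3)
/-- Local notation for the complexified range `ℂ³`. -/
local notation "ℂ³" => EuclideanSpace ℂ (Fin 3)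

/-! ### `B_{η;ξ}` by its symbol -/

/-- **The frequency-comparable Euler form about an arbitrary base triple, by its symbol**:
`⟨B_{η;ξ}(u,v), w⟩ = -πi ∫_{ξ₁+ξ₂+ξ₃=0} η_ξ(|ξ₁|,|ξ₂|,|ξ₃|) Λ_{ξ₁,ξ₂,ξ₃}(û(ξ₁), v̂(ξ₂), ŵ(ξ₃))` with
`η_ξ = etaAt ξ ε₀` (the tree's `betaForm` is the `xi0` instance). Bochner junk `0`.
[cite: Tao2016AveragedNS, §3.3 p. 16] -/
def betaFormAt (ξ : Fin 3 → ℝ³) (ε₀ : ℝ) (u v w : L2C) : ℂ :=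
  -(Real.pi * Complex.I) *
    ∫ p : ℝ³ × ℝ³, ((etaAt ξ ε₀ ‖p.1‖ ‖p.2‖ ‖-p.1 - p.2‖ : ℝ) : ℂ) *
      Λ p.1 p.2 (fourierFn u p.1) (fourierFn v p.2) (fourierFn w (-p.1 - p.2))

/-- At `ξ = xi0` the parametrised form is the tree's `B_η` (by `rfl`, `etaAt_xi0`).
[cite: Tao2016AveragedNS, §3.3 p. 16] -/
theorem betaFormAt_xi0 (ε₀ : ℝ) : betaFormAt xi0 ε₀ = betaForm ε₀ := rfl

/-! ### Step 1: `η_ξ(1, eˣ, eʸ) = F₁(x) F₂(y)` with smooth compactly supported profiles -/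

/-- The **logarithmic profiles** of the comparability weight about `ξ`:
`Fⱼ(x) = φ((eˣ - |ξ j|/|ξ 0|)/(10ε₀²))`. [cite: Tao2016AveragedNS, §3.3 p. 16] -/
def etaProfileAt (ξ : Fin 3 → ℝ³) (ε₀ : ℝ) (j : Fin 3) (x : ℝ) : ℝ :=
  freqCutoff ((Real.exp x - ‖ξ j‖ / ‖ξ 0‖) / (10 * ε₀ ^ 2))

/-- **`η_ξ(N₁,N₂,N₃) = F₁(log N₂ - log N₁) F₂(log N₃ - log N₁)`** for positive `Nᵢ`.
[cite: Tao2016AveragedNS, §3.3 p. 16] -/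
theorem etaAt_eq_etaProfileAt (ξ : Fin 3 → ℝ³) (ε₀ : ℝ) {N₁ N₂ N₃ : ℝ} (h₁ : 0 < N₁) (h₂ : 0 < N₂)
    (h₃ : 0 < N₃) :
    etaAt ξ ε₀ N₁ N₂ N₃ =
      etaProfileAt ξ ε₀ 1 (Real.log N₂ - Real.log N₁) * etaProfileAt ξ ε₀ 2 (Real.log N₃ - Real.log N₁) := by
  unfold etaAt etaProfileAt
  rw [Real.exp_sub, Real.exp_log h₂, Real.exp_log h₁, Real.exp_sub, Real.exp_log h₃, Real.exp_log h₁]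

/-- The profiles are smooth. [cite: Tao2016AveragedNS, §3.3 p. 16] -/
theorem contDiff_etaProfileAt (ξ : Fin 3 → ℝ³) (ε₀ : ℝ) (j : Fin 3) {n : ℕ∞} :
    ContDiff ℝ n (etaProfileAt ξ ε₀ j) :=
  contDiff_freqCutoff.comp ((Real.contDiff_exp.sub contDiff_const).div_const _)

/-- For moduli in `[1/2, 2]` the ratios `|ξ j|/|ξ 0|` are at least `1/4`. [folklore] -/
private theorem quarter_le_norm_div {ξ : Fin 3 → ℝ³} (hξ : ∀ j, 1 / 2 ≤ ‖ξ j‖ ∧ ‖ξ j‖ ≤ 2) (j : Fin 3) :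
    1 / 4 ≤ ‖ξ j‖ / ‖ξ 0‖ := by
  have h0 : 0 < ‖ξ 0‖ := by linarith [(hξ 0).1]
  rw [le_div_iff₀ h0]
  linarith [(hξ j).1, (hξ 0).2]

variable {ξ : Fin 3 → ℝ³} {ε₀ : ℝ}

/-- **The profiles are compactly supported** when `20ε₀² < |ξ j|/|ξ 0|` — here from `ε₀ ≤ 1/10` and
moduli in `[1/2, 2]` (ratio `≥ 1/4`): `Fⱼ` vanishes off `[log(rⱼ - 20ε₀²), log(rⱼ + 20ε₀²)]`,
`rⱼ = |ξ j|/|ξ 0|` ("`(x,y) ↦ η(1,eˣ,eʸ)` is a smooth compactly supported function", Tao p. 16).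
[cite: Tao2016AveragedNS, §3.3 p. 16] -/
theorem hasCompactSupport_etaProfileAt (hξ : ∀ j, 1 / 2 ≤ ‖ξ j‖ ∧ ‖ξ j‖ ≤ 2) (hε : 0 < ε₀)
    (hε' : ε₀ ≤ 1 / 10) (j : Fin 3) : HasCompactSupport (etaProfileAt ξ ε₀ j) := by
  set r : ℝ := ‖ξ j‖ / ‖ξ 0‖ with hr
  have hδ : 0 < 10 * ε₀ ^ 2 := by positivity
  have h20 : 20 * ε₀ ^ 2 < r := by
    have h1 : 1 / 4 ≤ r := quarter_le_norm_div hξ j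
    nlinarith
  have hlo : 0 < r - 20 * ε₀ ^ 2 := by linarith
  have hhi : 0 < r + 20 * ε₀ ^ 2 := by positivity
  refine HasCompactSupport.intro (K := Icc (Real.log (r - 20 * ε₀ ^ 2)) (Real.log (r + 20 * ε₀ ^ 2)))
    isCompact_Icc fun x hx => ?_
  unfold etaProfileAt
  refine freqCutoff_eq_zero ?_
  rw [mem_Icc, not_and_or, not_le, not_le] at hx
  rcases hx with hx | hx
  · -- `eˣ < r - 20ε₀²`
    have hex : Real.exp x < r - 20 * ε₀ ^ 2 := by
      calc Real.exp x < Real.exp (Real.log (r - 20 * ε₀ ^ 2)) := Real.exp_lt_exp.2 hx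
        _ = r - 20 * ε₀ ^ 2 := Real.exp_log hlo
    have h : (Real.exp x - r) / (10 * ε₀ ^ 2) ≤ -2 := by
      rw [div_le_iff₀ hδ]
      linarith
    have h' : 2 ≤ -((Real.exp x - r) / (10 * ε₀ ^ 2)) := by linarith
    exact h'.trans (neg_le_abs _)
  · -- `r + 20ε₀² < eˣ`
    have hex : r + 20 * ε₀ ^ 2 < Real.exp x := by
      calc r + 20 * ε₀ ^ 2 = Real.exp (Real.log (r + 20 * ε₀ ^ 2)) := (Real.exp_log hhi).symm
        _ < Real.exp x := Real.exp_lt_exp.2 hx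
    have h : 2 ≤ (Real.exp x - r) / (10 * ε₀ ^ 2) := by
      rw [le_div_iff₀ hδ]
      linarith
    exact h.trans (le_abs_self _)

/-- The complexified profile `x ↦ (Fⱼ(x) : ℂ)` is smooth. [cite: Tao2016AveragedNS, §3.3 p. 16] -/
theorem contDiff_etaProfileAt_ofReal (ξ : Fin 3 → ℝ³) (ε₀ : ℝ) (j : Fin 3) {n : ℕ∞} :
    ContDiff ℝ n fun x => ((etaProfileAt ξ ε₀ j x : ℝ) : ℂ) :=
  Complex.ofRealCLM.contDiff.comp (contDiff_etaProfileAt ξ ε₀ j)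

/-- The complexified profile is compactly supported. [cite: Tao2016AveragedNS, §3.3 p. 16] -/
theorem hasCompactSupport_etaProfileAt_ofReal (hξ : ∀ j, 1 / 2 ≤ ‖ξ j‖ ∧ ‖ξ j‖ ≤ 2) (hε : 0 < ε₀)
    (hε' : ε₀ ≤ 1 / 10) (j : Fin 3) :
    HasCompactSupport fun x => ((etaProfileAt ξ ε₀ j x : ℝ) : ℂ) :=
  (hasCompactSupport_etaProfileAt hξ hε hε' j).comp_left Complex.ofReal_zero

/-! ### Step 2: Fourier inversion — `Fⱼ = 𝓕⁻ϕⱼ` with `ϕⱼ = 𝓕Fⱼ` Schwartz -/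

/-- The profile `Fⱼ` as a Schwartz function (smooth and compactly supported).
[cite: Tao2016AveragedNS, §3.3 p. 16] -/
def etaProfileAtS (hξ : ∀ j, 1 / 2 ≤ ‖ξ j‖ ∧ ‖ξ j‖ ≤ 2) (hε : 0 < ε₀) (hε' : ε₀ ≤ 1 / 10)
    (j : Fin 3) : 𝓢(ℝ, ℂ) :=
  (hasCompactSupport_etaProfileAt_ofReal hξ hε hε' j).toSchwartzMap (contDiff_etaProfileAt_ofReal ξ ε₀ j)

/-- Values of the Schwartz profile. [folklore] -/
@[simp] private theorem etaProfileAtS_apply (hξ : ∀ j, 1 / 2 ≤ ‖ξ j‖ ∧ ‖ξ j‖ ≤ 2) (hε : 0 < ε₀)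
    (hε' : ε₀ ≤ 1 / 10) (j : Fin 3) (x : ℝ) :
    etaProfileAtS hξ hε hε' j x = ((etaProfileAt ξ ε₀ j x : ℝ) : ℂ) := rfl

/-- **The rapidly decreasing weights `ϕⱼ = 𝓕Fⱼ`** (Schwartz). [cite: Tao2016AveragedNS, §3.3 p. 16] -/
def etaPhiAt (hξ : ∀ j, 1 / 2 ≤ ‖ξ j‖ ∧ ‖ξ j‖ ≤ 2) (hε : 0 < ε₀) (hε' : ε₀ ≤ 1 / 10) (j : Fin 3) :
    𝓢(ℝ, ℂ) :=
  𝓕 (etaProfileAtS hξ hε hε' j)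

/-- **Fourier inversion for the profiles**: `∫ e^{2πisx} ϕⱼ(s) ds = Fⱼ(x)` for every `x`.
[cite: Tao2016AveragedNS, §3.3 p. 16] -/
theorem integral_imagExp_mul_etaPhiAt (hξ : ∀ j, 1 / 2 ≤ ‖ξ j‖ ∧ ‖ξ j‖ ≤ 2) (hε : 0 < ε₀)
    (hε' : ε₀ ≤ 1 / 10) (j : Fin 3) (x : ℝ) :
    ∫ s : ℝ, imagExp (2 * Real.pi) (s * x) * etaPhiAt hξ hε hε' j s =
      ((etaProfileAt ξ ε₀ j x : ℝ) : ℂ) := by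
  have h : (𝓕⁻ (etaPhiAt hξ hε hε' j) : 𝓢(ℝ, ℂ)) = etaProfileAtS hξ hε hε' j :=
    fourierInv_fourier_eq (etaProfileAtS hξ hε hε' j)
  have h2 : ((etaProfileAt ξ ε₀ j x : ℝ) : ℂ) = 𝓕⁻ (⇑(etaPhiAt hξ hε hε' j)) x := by
    rw [← SchwartzMap.fourierInv_coe, h, etaProfileAtS_apply]
  rw [h2, Real.fourierInv_eq']
  refine integral_congr_ae (Eventually.of_forall fun s => ?_)
  simp only [imagExp, smul_eq_mul, Real.inner_apply]

/-! ### Step 3: the complex averaging datum on `Ω = ℝ²` (Cauchy density of `TaoAveragedBetaForm`) -/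

/-- The **complex weight absorbed into `m₁`**: `c(s) = ϕ₁(s₂) ϕ₂(s₃) (1+s₂²)(1+s₃²)` (so that
`c dμ = ϕ₁(s₂)ϕ₂(s₃) ds₂ds₃`). [cite: Tao2016AveragedNS, §3.3 p. 16] -/
def betaCoefAt (hξ : ∀ j, 1 / 2 ≤ ‖ξ j‖ ∧ ‖ξ j‖ ≤ 2) (hε : 0 < ε₀) (hε' : ε₀ ≤ 1 / 10) (s : ℝ × ℝ) : ℂ :=
  etaPhiAt hξ hε hε' 1 s.1 * etaPhiAt hξ hε hε' 2 s.2 * (((1 + s.1 ^ 2) * (1 + s.2 ^ 2) : ℝ) : ℂ)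

/-- `c` is continuous. [folklore] -/
private theorem continuous_betaCoefAt (hξ : ∀ j, 1 / 2 ≤ ‖ξ j‖ ∧ ‖ξ j‖ ≤ 2) (hε : 0 < ε₀) (hε' : ε₀ ≤ 1 / 10) : Continuous (betaCoefAt hξ hε hε') := by
  unfold betaCoefAt
  have h1 := (etaPhiAt hξ hε hε' 1).continuous
  have h2 := (etaPhiAt hξ hε hε' 2).continuous
  fun_prop

/-- `|c(s)| = |ϕ₁(s₂)| |ϕ₂(s₃)| (1+s₂²)(1+s₃²)`. [folklore] -/
private theorem norm_betaCoefAt (hξ : ∀ j, 1 / 2 ≤ ‖ξ j‖ ∧ ‖ξ j‖ ≤ 2) (hε : 0 < ε₀) (hε' : ε₀ ≤ 1 / 10) (s : ℝ × ℝ) :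
    ‖betaCoefAt hξ hε hε' s‖ = ‖etaPhiAt hξ hε hε' 1 s.1‖ * ‖etaPhiAt hξ hε hε' 2 s.2‖ * ((1 + s.1 ^ 2) * (1 + s.2 ^ 2)) := by
  unfold betaCoefAt
  rw [norm_mul, norm_mul, Complex.norm_real, Real.norm_of_nonneg (by positivity)]

/-- The density times the weight: `d(s) c(s) = ϕ₁(s₂) ϕ₂(s₃)`. [folklore] -/
private theorem cauchyDensity_mul_betaCoefAt (hξ : ∀ j, 1 / 2 ≤ ‖ξ j‖ ∧ ‖ξ j‖ ≤ 2) (hε : 0 < ε₀) (hε' : ε₀ ≤ 1 / 10) (s : ℝ × ℝ) :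
    ((cauchyDensity s : ℝ) : ℂ) * betaCoefAt hξ hε hε' s = etaPhiAt hξ hε hε' 1 s.1 * etaPhiAt hξ hε hε' 2 s.2 := by
  have h := cauchyDensity_mul_weight s
  unfold betaCoefAt
  calc ((cauchyDensity s : ℝ) : ℂ) * (etaPhiAt hξ hε hε' 1 s.1 * etaPhiAt hξ hε hε' 2 s.2 *
        (((1 + s.1 ^ 2) * (1 + s.2 ^ 2) : ℝ) : ℂ))
      = etaPhiAt hξ hε hε' 1 s.1 * etaPhiAt hξ hε hε' 2 s.2 *
          (((cauchyDensity s : ℝ) * ((1 + s.1 ^ 2) * (1 + s.2 ^ 2)) : ℝ) : ℂ) := by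
        push_cast
        ring
    _ = etaPhiAt hξ hε hε' 1 s.1 * etaPhiAt hξ hε hε' 2 s.2 := by rw [h]; push_cast; ring

/-- The density times `|c|`: `d(s) |c(s)| = |ϕ₁(s₂)| |ϕ₂(s₃)|`. [folklore] -/
private theorem cauchyDensity_mul_norm_betaCoefAt (hξ : ∀ j, 1 / 2 ≤ ‖ξ j‖ ∧ ‖ξ j‖ ≤ 2) (hε : 0 < ε₀) (hε' : ε₀ ≤ 1 / 10) (s : ℝ × ℝ) :
    (cauchyDensity s : ℝ) * ‖betaCoefAt hξ hε hε' s‖ = ‖etaPhiAt hξ hε hε' 1 s.1‖ * ‖etaPhiAt hξ hε hε' 2 s.2‖ := by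
  have h := cauchyDensity_mul_weight s
  rw [norm_betaCoefAt]
  calc (cauchyDensity s : ℝ) * (‖etaPhiAt hξ hε hε' 1 s.1‖ * ‖etaPhiAt hξ hε hε' 2 s.2‖ * ((1 + s.1 ^ 2) * (1 + s.2 ^ 2)))
      = ‖etaPhiAt hξ hε hε' 1 s.1‖ * ‖etaPhiAt hξ hε hε' 2 s.2‖ *
          ((cauchyDensity s : ℝ) * ((1 + s.1 ^ 2) * (1 + s.2 ^ 2))) := by ring
    _ = _ := by rw [h, mul_one]

/-- **The three random symbols of the `B_η` datum**: `m₁ = c(s) |ξ|^{-2πi(s₂+s₃)}`,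
`m₂ = |ξ|^{2πis₂}`, `m₃ = |ξ|^{2πis₃}` (Tao's `D^{-it₂-it₃}`, `D^{it₂}`, `D^{it₃}` with `tⱼ = 2πsⱼ` and
the weight `ϕ` absorbed into `m₁`). [cite: Tao2016AveragedNS, §3.3 p. 16] -/
def betaSymbolAt (hξ : ∀ j, 1 / 2 ≤ ‖ξ j‖ ∧ ‖ξ j‖ ≤ 2) (hε : 0 < ε₀) (hε' : ε₀ ≤ 1 / 10) (i : Fin 3) (s : ℝ × ℝ) (ξ : ℝ³) : ℂ :=
  if i = 0 then betaCoefAt hξ hε hε' s * imagPow (-(2 * Real.pi * (s.1 + s.2))) ξ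
  else if i = 1 then imagPow (2 * Real.pi * s.1) ξ else imagPow (2 * Real.pi * s.2) ξ

/-- `m₁ = c(s) |ξ|^{-2πi(s₂+s₃)}`. [cite: Tao2016AveragedNS, §3.3 p. 16] -/
theorem betaSymbolAt_zero (hξ : ∀ j, 1 / 2 ≤ ‖ξ j‖ ∧ ‖ξ j‖ ≤ 2) (hε : 0 < ε₀) (hε' : ε₀ ≤ 1 / 10) (s : ℝ × ℝ) :
    betaSymbolAt hξ hε hε' 0 s = fun ξ => betaCoefAt hξ hε hε' s * imagPow (-(2 * Real.pi * (s.1 + s.2))) ξ := by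
  funext ξ
  simp [betaSymbolAt]

/-- `m₂ = |ξ|^{2πis₂}`. [cite: Tao2016AveragedNS, §3.3 p. 16] -/
theorem betaSymbolAt_one (hξ : ∀ j, 1 / 2 ≤ ‖ξ j‖ ∧ ‖ξ j‖ ≤ 2) (hε : 0 < ε₀) (hε' : ε₀ ≤ 1 / 10) (s : ℝ × ℝ) :
    betaSymbolAt hξ hε hε' 1 s = imagPow (2 * Real.pi * s.1) := by
  funext ξ
  simp [betaSymbolAt]

/-- `m₃ = |ξ|^{2πis₃}`. [cite: Tao2016AveragedNS, §3.3 p. 16] -/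
theorem betaSymbolAt_two (hξ : ∀ j, 1 / 2 ≤ ‖ξ j‖ ∧ ‖ξ j‖ ≤ 2) (hε : 0 < ε₀) (hε' : ε₀ ≤ 1 / 10) (s : ℝ × ℝ) :
    betaSymbolAt hξ hε hε' 2 s = imagPow (2 * Real.pi * s.2) := by
  funext ξ
  simp [betaSymbolAt, show (2 : Fin 3) ≠ 0 by decide, show (2 : Fin 3) ≠ 1 by decide]

/-- Each `m_{i,s}` is a complex Fourier multiplier of order `0`. [cite: Tao2016AveragedNS, §3.3 p. 16] -/
theorem isComplexSymbol_betaSymbolAt (hξ : ∀ j, 1 / 2 ≤ ‖ξ j‖ ∧ ‖ξ j‖ ≤ 2) (hε : 0 < ε₀) (hε' : ε₀ ≤ 1 / 10) (i : Fin 3) (s : ℝ × ℝ) :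
    IsComplexSymbol (betaSymbolAt hξ hε hε' i s) := by
  fin_cases i
  · simp only [Fin.zero_eta, betaSymbolAt_zero]
    exact (isComplexSymbol_imagPow _).const_mul _
  · simp only [Fin.mk_one, betaSymbolAt_one]
    exact isComplexSymbol_imagPow _
  · simp only [Fin.reduceFinMk, betaSymbolAt_two]
    exact isComplexSymbol_imagPow _

/-- `s ↦ m_{i,s}(ξ)` is measurable. [folklore] -/
private theorem measurable_betaSymbolAt (hξ : ∀ j, 1 / 2 ≤ ‖ξ j‖ ∧ ‖ξ j‖ ≤ 2) (hε : 0 < ε₀) (hε' : ε₀ ≤ 1 / 10) (i : Fin 3) (ξ : ℝ³) :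
    Measurable fun s : ℝ × ℝ => betaSymbolAt hξ hε hε' i s ξ := by
  have hc := (continuous_betaCoefAt hξ hε hε').measurable
  fin_cases i
  · simp only [Fin.zero_eta, betaSymbolAt_zero]
    exact hc.mul ((measurable_imagPow_left ξ).comp (by fun_prop))
  · simp only [Fin.mk_one, betaSymbolAt_one]
    exact (measurable_imagPow_left ξ).comp (by fun_prop)
  · simp only [Fin.reduceFinMk, betaSymbolAt_two]
    exact (measurable_imagPow_left ξ).comp (by fun_prop)

/-- **The integrability conditions (3.5) for the `B_η` datum**: for all `k₁ k₂ k₃`,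
`∫ ‖m₁‖_{k₁} ‖m₂‖_{k₂} ‖m₃‖_{k₃} dμ < ∞`, from `‖D^{it}‖_k ≤ A_k (1+|t|)ᵏ` and the finiteness of all
moments of `ϕⱼ`. [cite: Tao2016AveragedNS, §3.3 p. 16 and (3.5)] -/
theorem betaMomentAt_lt_top (hξ : ∀ j, 1 / 2 ≤ ‖ξ j‖ ∧ ‖ξ j‖ ≤ 2) (hε : 0 < ε₀) (hε' : ε₀ ≤ 1 / 10) (k₁ k₂ k₃ : ℕ) :
    ∫⁻ s, symbolSeminorm k₁ (betaSymbolAt hξ hε hε' 0 s) * symbolSeminorm k₂ (betaSymbolAt hξ hε hε' 1 s) *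
        symbolSeminorm k₃ (betaSymbolAt hξ hε hε' 2 s) ∂betaDatumMeasure < ∞ := by
  -- pointwise polynomial bound
  have hpt : ∀ s : ℝ × ℝ,
      symbolSeminorm k₁ (betaSymbolAt hξ hε hε' 0 s) * symbolSeminorm k₂ (betaSymbolAt hξ hε hε' 1 s) *
          symbolSeminorm k₃ (betaSymbolAt hξ hε hε' 2 s) ≤
        ENNReal.ofReal (‖betaCoefAt hξ hε hε' s‖ * betaMomentBound k₁ k₂ k₃ s) := by
    intro s
    have hA₁ := imagPowConst_nonneg k₁
    have hA₂ := imagPowConst_nonneg k₂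
    have hA₃ := imagPowConst_nonneg k₃
    have h0 : symbolSeminorm k₁ (betaSymbolAt hξ hε hε' 0 s) ≤
        ENNReal.ofReal (‖betaCoefAt hξ hε hε' s‖ * (imagPowConst k₁ * (1 + |2 * Real.pi * (s.1 + s.2)|) ^ k₁)) := by
      rw [betaSymbolAt_zero]
      refine (symbolSeminorm_const_mul_le (contDiffOn_imagPow _) _ k₁).trans ?_
      rw [ENNReal.ofReal_mul (norm_nonneg _), ofReal_norm]
      gcongr
      refine (symbolSeminorm_imagPow_le k₁ _).trans (le_of_eq ?_)
      rw [abs_neg]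
    have h1 : symbolSeminorm k₂ (betaSymbolAt hξ hε hε' 1 s) ≤
        ENNReal.ofReal (imagPowConst k₂ * (1 + |2 * Real.pi * s.1|) ^ k₂) := by
      rw [betaSymbolAt_one]
      exact symbolSeminorm_imagPow_le k₂ _
    have h2 : symbolSeminorm k₃ (betaSymbolAt hξ hε hε' 2 s) ≤
        ENNReal.ofReal (imagPowConst k₃ * (1 + |2 * Real.pi * s.2|) ^ k₃) := by
      rw [betaSymbolAt_two]
      exact symbolSeminorm_imagPow_le k₃ _
    calc _ ≤ ENNReal.ofReal (‖betaCoefAt hξ hε hε' s‖ * (imagPowConst k₁ * (1 + |2 * Real.pi * (s.1 + s.2)|) ^ k₁)) *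
          ENNReal.ofReal (imagPowConst k₂ * (1 + |2 * Real.pi * s.1|) ^ k₂) *
            ENNReal.ofReal (imagPowConst k₃ * (1 + |2 * Real.pi * s.2|) ^ k₃) :=
          mul_le_mul' (mul_le_mul' h0 h1) h2
      _ = ENNReal.ofReal (‖betaCoefAt hξ hε hε' s‖ * betaMomentBound k₁ k₂ k₃ s) := by
          rw [← ENNReal.ofReal_mul (by positivity), ← ENNReal.ofReal_mul (by positivity)]
          unfold betaMomentBound
          ring_nf
  -- integrate against the density
  refine lt_of_le_of_lt (lintegral_mono hpt) ?_
  have hmeas : AEMeasurable (fun s : ℝ × ℝ => ENNReal.ofReal (‖betaCoefAt hξ hε hε' s‖ * betaMomentBound k₁ k₂ k₃ s))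
      volume :=
    (ENNReal.measurable_ofReal.comp (((continuous_betaCoefAt hξ hε hε').norm.mul
      (continuous_betaMomentBound k₁ k₂ k₃)).measurable)).aemeasurable
  rw [betaDatumMeasure, lintegral_withDensity_eq_lintegral_mul₀ measurable_cauchyDensity.coe_nnreal_ennreal.aemeasurable
    hmeas]
  -- the real integrand `d(s) |c(s)| P(s) ≤ C (1+|s₂|)^a |ϕ₁(s₂)| (1+|s₃|)^b |ϕ₂(s₃)|` is integrable
  set C : ℝ := imagPowConst k₁ * imagPowConst k₂ * imagPowConst k₃ * (2 * Real.pi) ^ (k₁ + k₂ + k₃) with hC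
  have hC0 : 0 ≤ C := by
    have := imagPowConst_nonneg k₁
    have := imagPowConst_nonneg k₂
    have := imagPowConst_nonneg k₃
    positivity
  have hint : Integrable (fun s : ℝ × ℝ => (cauchyDensity s : ℝ) * (‖betaCoefAt hξ hε hε' s‖ * betaMomentBound k₁ k₂ k₃ s)) := by
    have hprod : Integrable (fun s : ℝ × ℝ =>
        C * (((1 + |s.1|) ^ (k₁ + k₂) * ‖etaPhiAt hξ hε hε' 1 s.1‖) * ((1 + |s.2|) ^ (k₁ + k₃) * ‖etaPhiAt hξ hε hε' 2 s.2‖))) := by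
      have h := ((integrable_one_add_abs_pow_mul (etaPhiAt hξ hε hε' 1) (k₁ + k₂)).mul_prod
        (integrable_one_add_abs_pow_mul (etaPhiAt hξ hε hε' 2) (k₁ + k₃))).const_mul C
      rw [← Measure.volume_eq_prod] at h
      exact h
    refine hprod.mono' ?_ (Eventually.of_forall fun s => ?_)
    · exact ((NNReal.continuous_coe.comp continuous_cauchyDensity).mul
        ((continuous_betaCoefAt hξ hε hε').norm.mul (continuous_betaMomentBound k₁ k₂ k₃))).aestronglyMeasurable
    · rw [Real.norm_of_nonneg (mul_nonneg (cauchyDensity s).coe_nonneg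
        (mul_nonneg (norm_nonneg _) (betaMomentBound_nonneg _ _ _ _))), ← mul_assoc,
        cauchyDensity_mul_norm_betaCoefAt]
      calc ‖etaPhiAt hξ hε hε' 1 s.1‖ * ‖etaPhiAt hξ hε hε' 2 s.2‖ * betaMomentBound k₁ k₂ k₃ s
          ≤ ‖etaPhiAt hξ hε hε' 1 s.1‖ * ‖etaPhiAt hξ hε hε' 2 s.2‖ *
              (C * ((1 + |s.1|) ^ (k₁ + k₂) * (1 + |s.2|) ^ (k₁ + k₃))) := by
            gcongr
            exact betaMomentBound_le k₁ k₂ k₃ s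
        _ = _ := by ring
  refine lt_of_le_of_lt (le_of_eq (lintegral_congr fun s => ?_)) hint.lintegral_lt_top
  simp only [Pi.mul_apply]
  rw [ENNReal.ofReal_mul (cauchyDensity s).coe_nonneg, ENNReal.ofReal_coe_nnreal]

/-- **The complex averaging datum of §3.3 representing `B_η` as a complex average of `B`**:
`Ω = ℝ²` with `dμ = ((1+s₂²)(1+s₃²))⁻¹ ds`, symbols `m₁ = c(s)|ξ|^{-2πi(s₂+s₃)}`, `m₂ = |ξ|^{2πis₂}`,
`m₃ = |ξ|^{2πis₃}`, no rotations (`R = id`), no dilations (`λ = 1`) — Tao's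
`B_η = ∫∫ ⟨B(D^{-it₂-it₃}u, D^{it₂}v), D^{it₃}w⟩ ϕ(t₂,t₃) dt₂dt₃`. [cite: Tao2016AveragedNS, §3.3 p. 16] -/
def betaDatumAt (hξ : ∀ j, 1 / 2 ≤ ‖ξ j‖ ∧ ‖ξ j‖ ≤ 2) (hε : 0 < ε₀) (hε' : ε₀ ≤ 1 / 10) : ComplexAveragingDatum where
  Ω := ℝ × ℝ
  μ := betaDatumMeasure
  m := betaSymbolAt hξ hε hε'
  R _ _ := LinearIsometryEquiv.refl ℝ _
  lam _ _ := 1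
  isComplexSymbol := isComplexSymbol_betaSymbolAt hξ hε hε'
  det_R _ _ := LinearMap.det_id
  lam_pos _ _ := one_pos
  lam_bdd := ⟨1, fun _ _ => by norm_num⟩
  moment := betaMomentAt_lt_top hξ hε hε'
  measurable_m i ξ _ := measurable_betaSymbolAt hξ hε hε' i ξ
  measurable_R _ _ := measurable_const
  measurable_lam _ := measurable_const

/-! ### Step 4: the symbol of the average — `\widehat{m(D)u} = m û`, Fubini, inversion -/

/-- The slots of the `B_η` datum are the multipliers `m_{i,s}(D)` (no rotation, no dilation). [cite: Tao2016AveragedNS, §3.3 p. 16] -/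
theorem betaDatumAt_slot (hξ : ∀ j, 1 / 2 ≤ ‖ξ j‖ ∧ ‖ξ j‖ ≤ 2) (hε : 0 < ε₀) (hε' : ε₀ ≤ 1 / 10) (i : Fin 3) (s : ℝ × ℝ) (u : L2C) :
    (betaDatumAt hξ hε hε').slot i s u =
      fourierMultiplier ((isComplexSymbol_betaSymbolAt hξ hε hε' i s).memLp_top.toLp (betaSymbolAt hξ hε hε' i s)) u := by
  unfold ComplexAveragingDatum.slot ComplexAveragingDatum.symbolLp
  rw [show (betaDatumAt hξ hε hε').lam i s = 1 from rfl, dil_one,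
    show (betaDatumAt hξ hε hε').R i s = LinearIsometryEquiv.refl ℝ _ from rfl, rot_refl]
  rfl

/-- `\widehat{m_{i,s}(D) u} = m_{i,s} û` a.e. [cite: Tao2016AveragedNS, §1.1 p. 6] -/
theorem fourierFn_betaDatumAt_slot (hξ : ∀ j, 1 / 2 ≤ ‖ξ j‖ ∧ ‖ξ j‖ ≤ 2) (hε : 0 < ε₀) (hε' : ε₀ ≤ 1 / 10) (i : Fin 3) (s : ℝ × ℝ) (u : L2C) :
    fourierFn ((betaDatumAt hξ hε hε').slot i s u) =ᵐ[volume] fun ξ => betaSymbolAt hξ hε hε' i s ξ • fourierFn u ξ := by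
  rw [betaDatumAt_slot]
  exact fourierFn_fourierMultiplier_toLp _ u

/-- The **product of the three symbols on the frequency hyperplane**,
`Φ(s; ξ₁,ξ₂) = m₁(ξ₁) m₂(ξ₂) m₃(ξ₃)`, `ξ₃ = -ξ₁-ξ₂`. [cite: Tao2016AveragedNS, §3.3 p. 16] -/
def betaPhaseAt (hξ : ∀ j, 1 / 2 ≤ ‖ξ j‖ ∧ ‖ξ j‖ ≤ 2) (hε : 0 < ε₀) (hε' : ε₀ ≤ 1 / 10) (s : ℝ × ℝ) (p : ℝ³ × ℝ³) : ℂ :=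
  betaSymbolAt hξ hε hε' 0 s p.1 * betaSymbolAt hξ hε hε' 1 s p.2 * betaSymbolAt hξ hε hε' 2 s (-p.1 - p.2)

/-- **The phase identity**: `m₁(ξ₁)m₂(ξ₂)m₃(ξ₃) = c(s) e^{2πis₂(log|ξ₂| - log|ξ₁|)} e^{2πis₃(log|ξ₃| - log|ξ₁|)}`
(Tao: `N₁^{-it₂-it₃} N₂^{it₂} N₃^{it₃} = e^{it₂ log(N₂/N₁)} e^{it₃ log(N₃/N₁)}`). [cite: Tao2016AveragedNS, §3.3 p. 16] -/
theorem betaPhaseAt_eq (hξ : ∀ j, 1 / 2 ≤ ‖ξ j‖ ∧ ‖ξ j‖ ≤ 2) (hε : 0 < ε₀) (hε' : ε₀ ≤ 1 / 10) (s : ℝ × ℝ) (p : ℝ³ × ℝ³) :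
    betaPhaseAt hξ hε hε' s p = betaCoefAt hξ hε hε' s *
      (imagExp (2 * Real.pi) (s.1 * (Real.log ‖p.2‖ - Real.log ‖p.1‖)) *
        imagExp (2 * Real.pi) (s.2 * (Real.log ‖-p.1 - p.2‖ - Real.log ‖p.1‖))) := by
  unfold betaPhaseAt
  rw [betaSymbolAt_zero, betaSymbolAt_one, betaSymbolAt_two]
  simp only [imagPow, imagExp, mul_assoc]
  rw [← Complex.exp_add, ← Complex.exp_add, ← Complex.exp_add]
  congr 2
  push_cast
  ring

/-- `|Φ(s; ·)| = |c(s)|`. [folklore] -/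
private theorem norm_betaPhaseAt (hξ : ∀ j, 1 / 2 ≤ ‖ξ j‖ ∧ ‖ξ j‖ ≤ 2) (hε : 0 < ε₀) (hε' : ε₀ ≤ 1 / 10) (s : ℝ × ℝ) (p : ℝ³ × ℝ³) :
    ‖betaPhaseAt hξ hε hε' s p‖ = ‖betaCoefAt hξ hε hε' s‖ := by
  unfold betaPhaseAt
  rw [betaSymbolAt_zero, betaSymbolAt_one, betaSymbolAt_two]
  simp only [norm_mul, norm_imagPow, mul_one]

/-- `Φ` is jointly measurable in `(s, ξ₁, ξ₂)`. [folklore] -/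
private theorem measurable_betaPhaseAt (hξ : ∀ j, 1 / 2 ≤ ‖ξ j‖ ∧ ‖ξ j‖ ≤ 2) (hε : 0 < ε₀) (hε' : ε₀ ≤ 1 / 10) :
    Measurable fun q : (ℝ × ℝ) × (ℝ³ × ℝ³) => betaPhaseAt hξ hε hε' q.1 q.2 := by
  unfold betaPhaseAt
  simp only [betaSymbolAt_zero, betaSymbolAt_one, betaSymbolAt_two]
  have hc : Measurable fun q : (ℝ × ℝ) × (ℝ³ × ℝ³) => betaCoefAt hξ hε hε' q.1 :=
    (continuous_betaCoefAt hξ hε hε').measurable.comp measurable_fst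
  have h0 : Measurable fun q : (ℝ × ℝ) × (ℝ³ × ℝ³) => imagPow (-(2 * Real.pi * (q.1.1 + q.1.2))) q.2.1 :=
    measurable_imagPow.comp ((by fun_prop : Measurable fun q : (ℝ × ℝ) × (ℝ³ × ℝ³) =>
      -(2 * Real.pi * (q.1.1 + q.1.2))).prodMk (measurable_snd.fst))
  have h1 : Measurable fun q : (ℝ × ℝ) × (ℝ³ × ℝ³) => imagPow (2 * Real.pi * q.1.1) q.2.2 :=
    measurable_imagPow.comp ((by fun_prop : Measurable fun q : (ℝ × ℝ) × (ℝ³ × ℝ³) =>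
      2 * Real.pi * q.1.1).prodMk measurable_snd.snd)
  have h2 : Measurable fun q : (ℝ × ℝ) × (ℝ³ × ℝ³) => imagPow (2 * Real.pi * q.1.2) (-q.2.1 - q.2.2) :=
    measurable_imagPow.comp ((by fun_prop : Measurable fun q : (ℝ × ℝ) × (ℝ³ × ℝ³) =>
      2 * Real.pi * q.1.2).prodMk (measurable_snd.fst.neg.sub measurable_snd.snd))
  exact ((hc.mul h0).mul h1).mul h2

/-- **`⟨B(m₁(D)u, m₂(D)v), m₃(D)w⟩ = -πi ∫ Φ(s;ξ₁,ξ₂) Λ(û(ξ₁), v̂(ξ₂), ŵ(ξ₃))`** by `\widehat{m(D)u} = m û`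
and the trilinearity of `Λ` ((1.3) for the slots). [cite: Tao2016AveragedNS, (1.3) and §3.3 p. 16] -/
theorem eulerForm_betaDatumAt_slot (hξ : ∀ j, 1 / 2 ≤ ‖ξ j‖ ∧ ‖ξ j‖ ≤ 2) (hε : 0 < ε₀) (hε' : ε₀ ≤ 1 / 10) (s : ℝ × ℝ) (u v w : L2C) :
    eulerForm ((betaDatumAt hξ hε hε').slot 0 s u) ((betaDatumAt hξ hε hε').slot 1 s v) ((betaDatumAt hξ hε hε').slot 2 s w) =
      -(Real.pi * Complex.I) * ∫ p, betaPhaseAt hξ hε hε' s p * eulerIntegrand u v w p := by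
  rw [eulerForm_eq_integral]
  congr 1
  refine integral_congr_ae ?_
  filter_upwards [ae_prod_of_ae₁ (fourierFn_betaDatumAt_slot hξ hε hε' 0 s u),
    ae_prod_of_ae₂ (fourierFn_betaDatumAt_slot hξ hε hε' 1 s v),
    ae_prod_of_ae₃ (fourierFn_betaDatumAt_slot hξ hε hε' 2 s w)] with p h1 h2 h3
  simp only [eulerIntegrand, h1, h2, h3, Λ_smul₁, Λ_smul₂, Λ_smul₃, betaPhaseAt]
  ring

/-- `c` is integrable against `μ` (`∫ |c| dμ = ∫∫ |ϕ₁||ϕ₂| < ∞`). [folklore] -/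
private theorem integrable_betaCoefAt (hξ : ∀ j, 1 / 2 ≤ ‖ξ j‖ ∧ ‖ξ j‖ ≤ 2) (hε : 0 < ε₀) (hε' : ε₀ ≤ 1 / 10) : Integrable (betaCoefAt hξ hε hε') betaDatumMeasure := by
  rw [betaDatumMeasure, integrable_withDensity_iff_integrable_smul measurable_cauchyDensity]
  have h : Integrable (fun s : ℝ × ℝ => etaPhiAt hξ hε hε' 1 s.1 * etaPhiAt hξ hε hε' 2 s.2) := by
    have h := ((etaPhiAt hξ hε hε' 1).integrable (μ := volume)).mul_prod
      ((etaPhiAt hξ hε hε' 2).integrable (μ := volume))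
    rw [← Measure.volume_eq_prod] at h
    exact h
  refine h.congr (Eventually.of_forall fun s => ?_)
  show etaPhiAt hξ hε hε' 1 s.1 * etaPhiAt hξ hε hε' 2 s.2 = cauchyDensity s • betaCoefAt hξ hε hε' s
  rw [NNReal.smul_def, Complex.real_smul, cauchyDensity_mul_betaCoefAt]

/-- **Fubini integrability**: `(s, ξ₁, ξ₂) ↦ Φ(s;ξ₁,ξ₂) Λ(û(ξ₁), v̂(ξ₂), ŵ(ξ₃))` is integrable on
`Ω × ℝ³ × ℝ³` for `u, v ∈ H¹⁰`, `w ∈ L²` (`|Φ| = |c(s)|` integrable, (1.3) absolutely convergent —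
"working first with Schwartz `u,v,w` to justify all the exchange of integrals, and then taking
limits" is replaced by the `H¹⁰` bound `integrable_Λ_fourierFn`). [cite: Tao2016AveragedNS, §3.3 p. 16] -/
theorem integrable_betaPhaseAt_mul (hξ : ∀ j, 1 / 2 ≤ ‖ξ j‖ ∧ ‖ξ j‖ ≤ 2) (hε : 0 < ε₀) (hε' : ε₀ ≤ 1 / 10) {u v : L2C} (w : L2C)
    (hu : FunctionSpaces.eFourierSobolevNorm 10 u < ∞) (hv : FunctionSpaces.eFourierSobolevNorm 10 v < ∞) :
    Integrable (Function.uncurry fun (s : ℝ × ℝ) (p : ℝ³ × ℝ³) =>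
      betaPhaseAt hξ hε hε' s p * eulerIntegrand u v w p) (betaDatumMeasure.prod volume) := by
  have hE : Integrable (eulerIntegrand u v w) volume := integrable_Λ_fourierFn w hu hv
  have hg : Integrable (fun q : (ℝ × ℝ) × (ℝ³ × ℝ³) => ‖betaCoefAt hξ hε hε' q.1‖ * ‖eulerIntegrand u v w q.2‖)
      (betaDatumMeasure.prod volume) :=
    (integrable_betaCoefAt hξ hε hε').norm.mul_prod hE.norm
  refine hg.mono' ?_ (Eventually.of_forall fun q => ?_)
  · exact ((measurable_betaPhaseAt hξ hε hε').aestronglyMeasurable).mul hE.1.comp_snd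
  · obtain ⟨s, p⟩ := q
    rw [Function.uncurry_apply_pair, norm_mul, norm_betaPhaseAt]

/-- **The `s`-integral of the phase is the comparability weight**: for `ξ₁, ξ₂, ξ₃ ≠ 0`,
`∫_Ω Φ(s;ξ₁,ξ₂) dμ(s) = ∫∫ ϕ₁(s₂)ϕ₂(s₃) e^{2πis₂ log(|ξ₂|/|ξ₁|)} e^{2πis₃ log(|ξ₃|/|ξ₁|)} ds = F₁ F₂ = η(|ξ₁|,|ξ₂|,|ξ₃|)`
(Fourier inversion, step 2). [cite: Tao2016AveragedNS, §3.3 p. 16] -/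
theorem integral_betaPhaseAt (hξ : ∀ j, 1 / 2 ≤ ‖ξ j‖ ∧ ‖ξ j‖ ≤ 2) (hε : 0 < ε₀) (hε' : ε₀ ≤ 1 / 10) {p : ℝ³ × ℝ³} (h₁ : p.1 ≠ 0) (h₂ : p.2 ≠ 0)
    (h₃ : -p.1 - p.2 ≠ 0) :
    ∫ s, betaPhaseAt hξ hε hε' s p ∂betaDatumMeasure = ((etaAt ξ ε₀ ‖p.1‖ ‖p.2‖ ‖-p.1 - p.2‖ : ℝ) : ℂ) := by
  rw [betaDatumMeasure, integral_withDensity_eq_integral_smul measurable_cauchyDensity]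
  have hpt : ∀ s : ℝ × ℝ, cauchyDensity s • betaPhaseAt hξ hε hε' s p =
      (imagExp (2 * Real.pi) (s.1 * (Real.log ‖p.2‖ - Real.log ‖p.1‖)) * etaPhiAt hξ hε hε' 1 s.1) *
        (imagExp (2 * Real.pi) (s.2 * (Real.log ‖-p.1 - p.2‖ - Real.log ‖p.1‖)) * etaPhiAt hξ hε hε' 2 s.2) := by
    intro s
    rw [NNReal.smul_def, Complex.real_smul, betaPhaseAt_eq, ← mul_assoc, cauchyDensity_mul_betaCoefAt]
    ring
  simp_rw [hpt]
  have hprod := integral_prod_mul (μ := (volume : Measure ℝ)) (ν := (volume : Measure ℝ))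
    (fun a : ℝ => imagExp (2 * Real.pi) (a * (Real.log ‖p.2‖ - Real.log ‖p.1‖)) * etaPhiAt hξ hε hε' 1 a)
    (fun b : ℝ => imagExp (2 * Real.pi) (b * (Real.log ‖-p.1 - p.2‖ - Real.log ‖p.1‖)) * etaPhiAt hξ hε hε' 2 b)
  rw [Measure.volume_eq_prod, hprod, integral_imagExp_mul_etaPhiAt, integral_imagExp_mul_etaPhiAt,
    etaAt_eq_etaProfileAt ξ ε₀ (norm_pos_iff.2 h₁) (norm_pos_iff.2 h₂) (norm_pos_iff.2 h₃)]
  push_cast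
  ring

/-- **The symbol of the `B_η` datum** (Tao p. 16: "From (1.3) and Fubini's theorem … we see that
`⟨B_η(u,v), w⟩ = -πi ∫_{ξ₁+ξ₂+ξ₃=0} η(|ξ₁|,|ξ₂|,|ξ₃|) Λ_{ξ₁,ξ₂,ξ₃}(û(ξ₁), v̂(ξ₂), ŵ(ξ₃))`"): for
`u, v ∈ H¹⁰`, `w ∈ L²`, the complex average of `B` over `betaDatumAt` is `betaForm`. [cite: Tao2016AveragedNS, §3.3 p. 16] -/
theorem betaDatumAt_average_eulerForm (hξ : ∀ j, 1 / 2 ≤ ‖ξ j‖ ∧ ‖ξ j‖ ≤ 2) (hε : 0 < ε₀) (hε' : ε₀ ≤ 1 / 10) {u v : L2C} (w : L2C)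
    (hu : FunctionSpaces.eFourierSobolevNorm 10 u < ∞) (hv : FunctionSpaces.eFourierSobolevNorm 10 v < ∞) :
    (betaDatumAt hξ hε hε').average eulerForm u v w = betaFormAt ξ ε₀ u v w := by
  change ∫ s, eulerForm ((betaDatumAt hξ hε hε').slot 0 s u) ((betaDatumAt hξ hε hε').slot 1 s v)
      ((betaDatumAt hξ hε hε').slot 2 s w) ∂betaDatumMeasure = betaFormAt ξ ε₀ u v w
  simp_rw [eulerForm_betaDatumAt_slot]
  rw [integral_const_mul]
  unfold betaFormAt
  congr 1
  rw [integral_integral_swap (integrable_betaPhaseAt_mul hξ hε hε' w hu hv)]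
  refine integral_congr_ae ?_
  filter_upwards [ae_prod_of_ae₁ ae_freq_ne_zero, ae_prod_of_ae₂ ae_freq_ne_zero, ae_prod_of_ae₃ ae_freq_ne_zero]
    with p h₁ h₂ h₃
  rw [integral_mul_const, integral_betaPhaseAt hξ hε hε' h₁ h₂ h₃]
  rfl

/-! ### The dilation-free discharge -/

/-- **Tao 2016, §3.3 at an arbitrary base triple, dilation-free**: for `0 < ε₀ ≤ 1/10` and moduli
`‖ξ j‖ ∈ [1/2, 2]`, `B_{η;ξ}` is a DILATION-FREE complex average of `B` (`betaDatumAt` has `λ ≡ 1`,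
`R = id`): `⟨B_{η;ξ}(u,v), w⟩ = ∫_Ω ⟨B(m₁(D)u, m₂(D)v), m₃(D)w⟩ dμ` for all `u, v, w ∈ H¹⁰_df ⊗ ℂ`.
[cite: Tao2016AveragedNS, §3.3 p. 16 and Remark 3.5 p. 20] -/
theorem betaFormAt_isComplexAverageNoDil (hξ : ∀ j, 1 / 2 ≤ ‖ξ j‖ ∧ ‖ξ j‖ ≤ 2) (hε : 0 < ε₀)
    (hε' : ε₀ ≤ 1 / 10) : IsComplexAverageNoDilOf (betaFormAt ξ ε₀) eulerForm :=
  ⟨betaDatumAt hξ hε hε', fun _ _ => rfl, fun _ _ w hu hv _ =>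
    (betaDatumAt_average_eulerForm hξ hε hε' w hu.1 hv.1).symm⟩

end Literature.Analysis.FluidPDE.Tao2016
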